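import Mathlib
import HarnessLib
import Literature.NumberTheory.LFunctions.LiouvilleCharSumLinnikBox

/-!
# `TypeIILiouville` (crux stmt-Parity-13322, route `LiouvilleMAD`), line `Sketch`: Stub U2

From twisted Möbius sums to twisted Liouville sums.  Since `λ = 𝟙_□ ⋆ μ` and `χ` is completely
multiplicative,

`‖∑_{k ≤ N} λ(k)χ(k)‖ ≤ ∑_{r ≤ √N} ‖M(N/r², χ)‖`, `M(n, χ) = ∑_{m ≤ n} χ(m)μ(m)`

(the tree's `LiouvilleCharSumLinnikBox.norm_sum_liouville_twist_le`).  Given a power saving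
`‖M(n, χ)‖ ≤ C n^{1−ε/2}` for `n ≥ N₀`, moduli `q ≤ n^ε` and characters `χ ≠ χ₀` whose `L(s, χ)`
has no zero in the box `1 − δ₀ ≤ Re s < 1`, `|Im s| ≤ n^ε + 1` (Stub U2mu of the line, received
here as the hypothesis `hμ`), the same saving follows for `∑_{k ≤ N} λ(k)χ(k)` with `q ≤ N^{ε/2}`:
for `r ≤ R₀ = ⌊N^{1/5}⌋` the length `n = ⌊N/r²⌋ ≥ N^{1/2}` is admissible (`q ≤ N^{ε/2} ≤ n^ε`,
`n^ε + 1 ≤ N^ε + 1`) and `C n^{1−ε/2} ≤ C N^{1−ε/2} r^{−3/2}` with `∑ r^{−3/2} < ∞`; for `r > R₀`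
the trivial bound `‖M(n, χ)‖ ≤ n ≤ N/r²` and `∑_{r > R₀} 1/r² ≤ 1/R₀ ≤ 2 N^{−1/5}` give
`≤ 2 N^{4/5} ≤ 2 N^{1−ε/2}` (`ε ≤ δ₀ ≤ 1/4`).
-/

noncomputable section

open Finset ArithmeticFunction Filter Asymptotics
open Literature.NumberTheory.LFunctions

namespace Summit.Parity.GeneralizedHardyLittlewood.Theorems.TypeIILiouville

/-- Summation of the two regimes: `∑_{0 < r ≤ S} f(r) ≤ (∑_r r^{-3/2}) A + N/R₀` if
`f(r) ≤ A r^{-3/2}` for `r ≤ R₀` and `f(r) ≤ N/r²` for `r > R₀` (`∑_{r > R₀} 1/r² ≤ 1/R₀`). -/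
theorem stubU2_sum_two_regimes_le {f : ℕ → ℝ} {S R₀ : ℕ} {A Nr : ℝ} (hR₀ : 1 ≤ R₀) (hA : 0 ≤ A)
    (hNr : 0 ≤ Nr) (hsmall : ∀ r ∈ Ioc 0 S, r ≤ R₀ → f r ≤ A * (1 / (r : ℝ) ^ (3 / 2 : ℝ)))
    (hlarge : ∀ r ∈ Ioc R₀ S, f r ≤ Nr * (1 / (r : ℝ) ^ 2)) :
    ∑ r ∈ Ioc 0 S, f r ≤ (∑' r : ℕ, 1 / (r : ℝ) ^ (3 / 2 : ℝ)) * A + Nr * (1 / R₀) := by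
  rw [← sum_filter_add_sum_filter_not (Ioc 0 S) (fun r ↦ r ≤ R₀)]
  have hfilt : (Ioc 0 S).filter (fun r ↦ ¬r ≤ R₀) = Ioc R₀ S := by
    ext r; simp only [mem_filter, mem_Ioc, not_le]; omega
  rw [hfilt]
  have hsum : Summable (fun r : ℕ ↦ 1 / (r : ℝ) ^ (3 / 2 : ℝ)) :=
    Real.summable_one_div_nat_rpow.mpr (by norm_num)
  refine add_le_add ?_ ?_
  · calc ∑ r ∈ (Ioc 0 S).filter (fun r ↦ r ≤ R₀), f r
        ≤ ∑ r ∈ (Ioc 0 S).filter (fun r ↦ r ≤ R₀), A * (1 / (r : ℝ) ^ (3 / 2 : ℝ)) :=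
          sum_le_sum fun r hr ↦ by rw [mem_filter] at hr; exact hsmall r hr.1 hr.2
      _ = A * ∑ r ∈ (Ioc 0 S).filter (fun r ↦ r ≤ R₀), (1 / (r : ℝ) ^ (3 / 2 : ℝ)) := by
          rw [mul_sum]
      _ ≤ A * ∑' r : ℕ, 1 / (r : ℝ) ^ (3 / 2 : ℝ) :=
          mul_le_mul_of_nonneg_left (hsum.sum_le_tsum _ fun r _ ↦ by positivity) hA
      _ = _ := mul_comm _ _
  · calc ∑ r ∈ Ioc R₀ S, f r ≤ ∑ r ∈ Ioc R₀ S, Nr * (1 / (r : ℝ) ^ 2) := sum_le_sum hlarge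
      _ = Nr * ∑ r ∈ Ioc R₀ S, (1 / (r : ℝ) ^ 2) := by rw [mul_sum]
      _ ≤ Nr * (1 / R₀) :=
          mul_le_mul_of_nonneg_left (SiegelWalfiszLiouville.sum_Ioc_inv_sq_le hR₀ _) hNr

/-- `(r·r)^{3/4} = r^{3/2}` for `r ≥ 0`. -/
theorem stubU2_mul_self_rpow {x : ℝ} (hx : 0 ≤ x) : (x * x) ^ (3 / 4 : ℝ) = x ^ (3 / 2 : ℝ) := by
  rw [← sq, ← Real.rpow_two, ← Real.rpow_mul hx]
  norm_num

/-- **Stub U2.** Given Stub U2mu (as `hμ`): for `0 < δ₀ ≤ 1/4` there are `0 < ε ≤ δ₀`, `C`, `N₀` such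
that for `N ≥ N₀`, `q ≤ N^{ε/2}`, `χ ≠ χ₀ mod q` with `L(z, χ) ≠ 0` on `1 − δ₀ ≤ Re z < 1`,
`|Im z| ≤ N^ε + 1`: `‖∑_{k≤N} λ(k)χ(k)‖ ≤ C N^{1−ε/2}` (`∑_{k≤N} λχ = ∑_{r²≤N} χ(r)² M(N/r², χ)`,
tree `LiouvilleCharSumLinnikBox.sum_liouville_twist_eq`; `r ≤ N^{1/5}` by `hμ`, larger `r` trivially). -/
theorem stub_U2
    (hμ : ∀ δ₀ : ℝ, 0 < δ₀ → δ₀ ≤ 1 / 4 → ∃ ε : ℝ, 0 < ε ∧ ε ≤ δ₀ ∧ ∃ C : ℝ, ∃ N₀ : ℕ,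
      ∀ N : ℕ, N₀ ≤ N → ∀ (q : ℕ) [NeZero q], (q : ℝ) ≤ (N : ℝ) ^ ε →
        ∀ χ : DirichletCharacter ℂ q, χ ≠ 1 →
          (∀ z : ℂ, 1 - δ₀ ≤ z.re → z.re < 1 → |z.im| ≤ (N : ℝ) ^ ε + 1 → χ.LFunction z ≠ 0) →
          ‖∑ n ∈ Icc 1 N, χ (n : ZMod q) * (ArithmeticFunction.moebius n : ℂ)‖ ≤
            C * (N : ℝ) ^ (1 - ε / 2)) :
    ∀ δ₀ : ℝ, 0 < δ₀ → δ₀ ≤ 1 / 4 → ∃ ε : ℝ, 0 < ε ∧ ε ≤ δ₀ ∧ ∃ C : ℝ, ∃ N₀ : ℕ,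
    ∀ N : ℕ, N₀ ≤ N → ∀ (q : ℕ) [NeZero q], (q : ℝ) ≤ (N : ℝ) ^ (ε / 2) →
      ∀ χ : DirichletCharacter ℂ q, χ ≠ 1 →
        (∀ z : ℂ, 1 - δ₀ ≤ z.re → z.re < 1 → |z.im| ≤ (N : ℝ) ^ ε + 1 → χ.LFunction z ≠ 0) →
        ‖∑ k ∈ Icc 1 N, (liouville k : ℂ) * χ (k : ZMod q)‖ ≤ C * (N : ℝ) ^ (1 - ε / 2) := by
  intro δ₀ hδ₀ hδ₀'
  obtain ⟨ε, hε0, hεδ, C, N₀, hM⟩ := hμ δ₀ hδ₀ hδ₀'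
  -- the constant: `T = ∑_r r^{-3/2}`, `C⁺ = max C 0`; the threshold `max N₀² 3¹⁰`
  obtain ⟨T, hT⟩ : ∃ T : ℝ, T = ∑' r : ℕ, 1 / (r : ℝ) ^ (3 / 2 : ℝ) := ⟨_, rfl⟩
  have hC0 : 0 ≤ max C 0 := le_max_right _ _
  refine ⟨ε, hε0, hεδ, T * max C 0 + 2, max (N₀ ^ 2) (3 ^ 10), fun N hN q _ hq χ hχ hzero ↦ ?_⟩
  have hNN₀ : N₀ ^ 2 ≤ N := le_of_max_le_left hN
  have hN3 : 3 ^ 10 ≤ N := le_of_max_le_right hN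
  have hN3r : (3 : ℝ) ^ (10 : ℕ) ≤ N := by exact_mod_cast hN3
  have hN1 : (1 : ℝ) ≤ N := le_trans (by norm_num) hN3r
  have hN0 : (0 : ℝ) < N := by linarith
  have hN0' : (0 : ℝ) ≤ N := hN0.le
  -- exponent bookkeeping: `3/4, 4/5 ≤ 1 − ε/2`
  have hε4 : ε ≤ 1 / 4 := hεδ.trans hδ₀'
  have ha34 : 3 / 4 ≤ 1 - ε / 2 := by linarith
  have ha45 : 4 / 5 ≤ 1 - ε / 2 := by linarith
  have ha0 : 0 ≤ 1 - ε / 2 := by linarith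
  -- powers of `N`
  have ePow : ∀ b c : ℝ, (N : ℝ) ^ b * (N : ℝ) ^ c = (N : ℝ) ^ (b + c) := fun b c =>
    (Real.rpow_add hN0 b c).symm
  have onePow : ∀ b : ℝ, 0 ≤ b → (1 : ℝ) ≤ (N : ℝ) ^ b := fun b hb => Real.one_le_rpow hN1 hb
  -- `3 ≤ N^{1/10}`, `2 ≤ N^{1/5}`
  have h3 : (3 : ℝ) ≤ (N : ℝ) ^ (1 / 10 : ℝ) :=
    calc (3 : ℝ) = ((3 : ℝ) ^ (10 : ℕ)) ^ (1 / 10 : ℝ) := by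
          rw [← Real.rpow_natCast, ← Real.rpow_mul (by norm_num)]; norm_num
      _ ≤ (N : ℝ) ^ (1 / 10 : ℝ) := Real.rpow_le_rpow (by positivity) hN3r (by norm_num)
  have h2 : (2 : ℝ) ≤ (N : ℝ) ^ (1 / 5 : ℝ) :=
    calc (2 : ℝ) ≤ 3 * 3 := by norm_num
      _ ≤ (N : ℝ) ^ (1 / 10 : ℝ) * (N : ℝ) ^ (1 / 10 : ℝ) :=
          mul_le_mul h3 h3 (by norm_num) (by linarith)
      _ = (N : ℝ) ^ (1 / 5 : ℝ) := by rw [ePow]; norm_num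
  -- the splitting point `R₀ = ⌊N^{1/5}⌋`
  obtain ⟨R₀, hR₀⟩ : ∃ R₀ : ℕ, R₀ = ⌊(N : ℝ) ^ (1 / 5 : ℝ)⌋₊ := ⟨_, rfl⟩
  have hR₀le : (R₀ : ℝ) ≤ (N : ℝ) ^ (1 / 5 : ℝ) := by
    rw [hR₀]; exact Nat.floor_le (Real.rpow_nonneg hN0' _)
  have hR₀ge : (N : ℝ) ^ (1 / 5 : ℝ) / 2 ≤ R₀ := by
    have := Nat.lt_floor_add_one ((N : ℝ) ^ (1 / 5 : ℝ)); rw [← hR₀] at this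
    linarith
  have hR₀1r : (1 : ℝ) ≤ R₀ := by linarith
  have hR₀1 : 1 ≤ R₀ := by exact_mod_cast hR₀1r
  have hR₀0 : (0 : ℝ) < R₀ := by linarith
  -- `D = N^{2/5}`, `E = N^{1/2}`: `3DE ≤ N`, `N₀ ≤ E`
  have hD1 : (1 : ℝ) ≤ (N : ℝ) ^ (2 / 5 : ℝ) := onePow _ (by norm_num)
  have hE1 : (1 : ℝ) ≤ (N : ℝ) ^ (1 / 2 : ℝ) := onePow _ (by norm_num)
  have hkey : 3 * (N : ℝ) ^ (2 / 5 : ℝ) * (N : ℝ) ^ (1 / 2 : ℝ) ≤ N := by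
    have e : (N : ℝ) ^ (1 / 10 : ℝ) * ((N : ℝ) ^ (2 / 5 : ℝ) * (N : ℝ) ^ (1 / 2 : ℝ)) = N := by
      rw [ePow, ePow]; norm_num
    have h0 : 0 ≤ (N : ℝ) ^ (2 / 5 : ℝ) * (N : ℝ) ^ (1 / 2 : ℝ) := by positivity
    calc 3 * (N : ℝ) ^ (2 / 5 : ℝ) * (N : ℝ) ^ (1 / 2 : ℝ)
        ≤ (N : ℝ) ^ (1 / 10 : ℝ) * ((N : ℝ) ^ (2 / 5 : ℝ) * (N : ℝ) ^ (1 / 2 : ℝ)) := by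
          rw [mul_assoc]; exact mul_le_mul_of_nonneg_right h3 h0
      _ = N := e
  have hD : (N : ℝ) ^ (2 / 5 : ℝ) = (N : ℝ) ^ (1 / 5 : ℝ) * (N : ℝ) ^ (1 / 5 : ℝ) := by
    rw [ePow]; norm_num
  have hN₀E : (N₀ : ℝ) ≤ (N : ℝ) ^ (1 / 2 : ℝ) := by
    rw [← Real.sqrt_eq_rpow]
    refine Real.le_sqrt_of_sq_le ?_
    exact_mod_cast hNN₀
  -- the Möbius sums at `N/r²`, small `r`
  have hsmall : ∀ r ∈ Ioc 0 (Nat.sqrt N), r ≤ R₀ →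
      ‖∑ m ∈ Icc 1 (N / (r * r)), χ (m : ZMod q) * (moebius m : ℂ)‖ ≤
        max C 0 * (N : ℝ) ^ (1 - ε / 2) * (1 / (r : ℝ) ^ (3 / 2 : ℝ)) := by
    intro r hr hrR
    rw [mem_Ioc] at hr
    have hr0 : 0 < r := hr.1
    have hr0' : (0 : ℝ) < r := by exact_mod_cast hr0
    have hr1' : (1 : ℝ) ≤ r := by exact_mod_cast hr0
    have hrR' : (r : ℝ) ≤ (N : ℝ) ^ (1 / 5 : ℝ) := le_trans (by exact_mod_cast hrR) hR₀le
    have hrr : ((r * r : ℕ) : ℝ) ≤ (N : ℝ) ^ (2 / 5 : ℝ) := by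
      push_cast; rw [hD]; exact mul_le_mul hrR' hrR' hr0'.le (Real.rpow_nonneg hN0' _)
    -- `n = ⌊N/r²⌋ ≥ N^{1/2}`
    have hlow : (N : ℝ) ^ (1 / 2 : ℝ) ≤ ((N / (r * r) : ℕ) : ℝ) :=
      LiouvilleCharSumLinnikBox.le_natDiv_of_le (Nat.mul_pos hr0 hr0) hrr hD1 hE1 hkey le_rfl
        (by linarith)
    have hn0 : (0 : ℝ) ≤ ((N / (r * r) : ℕ) : ℝ) := Nat.cast_nonneg _
    have hnN : ((N / (r * r) : ℕ) : ℝ) ≤ N := by exact_mod_cast Nat.div_le_self _ _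
    have hnN₀ : N₀ ≤ N / (r * r) := by exact_mod_cast hN₀E.trans hlow
    have hq' : (q : ℝ) ≤ ((N / (r * r) : ℕ) : ℝ) ^ ε := by
      refine hq.trans ?_
      rw [show ε / 2 = 1 / 2 * ε by ring, Real.rpow_mul hN0']
      exact Real.rpow_le_rpow (Real.rpow_nonneg hN0' _) hlow hε0.le
    have hzero' : ∀ z : ℂ, 1 - δ₀ ≤ z.re → z.re < 1 →
        |z.im| ≤ ((N / (r * r) : ℕ) : ℝ) ^ ε + 1 → χ.LFunction z ≠ 0 :=
      fun z h1 h2 h3 ↦ hzero z h1 h2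
        (h3.trans (add_le_add (Real.rpow_le_rpow hn0 hnN hε0.le) le_rfl))
    refine (hM (N / (r * r)) hnN₀ q hq' χ hχ hzero').trans ?_
    -- `C n^{1−ε/2} ≤ C⁺ N^{1−ε/2} r^{-3/2}`
    have hna : ((N / (r * r) : ℕ) : ℝ) ^ (1 - ε / 2) ≤
        (N : ℝ) ^ (1 - ε / 2) * (1 / (r : ℝ) ^ (3 / 2 : ℝ)) := by
      have hdiv : ((N / (r * r) : ℕ) : ℝ) ≤ (N : ℝ) / ((r : ℝ) * r) := by
        refine (Nat.cast_div_le).trans (le_of_eq ?_); rw [Nat.cast_mul]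
      have hrr1 : (1 : ℝ) ≤ (r : ℝ) * r := one_le_mul_of_one_le_of_one_le hr1' hr1'
      calc ((N / (r * r) : ℕ) : ℝ) ^ (1 - ε / 2) ≤ ((N : ℝ) / ((r : ℝ) * r)) ^ (1 - ε / 2) :=
            Real.rpow_le_rpow hn0 hdiv ha0
        _ = (N : ℝ) ^ (1 - ε / 2) / ((r : ℝ) * r) ^ (1 - ε / 2) :=
            Real.div_rpow hN0' (by positivity) _
        _ ≤ (N : ℝ) ^ (1 - ε / 2) / ((r : ℝ) * r) ^ (3 / 4 : ℝ) :=
            div_le_div_of_nonneg_left (Real.rpow_nonneg hN0' _) (by positivity)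
              (Real.rpow_le_rpow_of_exponent_le hrr1 ha34)
        _ = (N : ℝ) ^ (1 - ε / 2) * (1 / (r : ℝ) ^ (3 / 2 : ℝ)) := by
            rw [div_eq_mul_one_div, stubU2_mul_self_rpow hr0'.le]
    calc C * ((N / (r * r) : ℕ) : ℝ) ^ (1 - ε / 2)
        ≤ max C 0 * ((N / (r * r) : ℕ) : ℝ) ^ (1 - ε / 2) :=
          mul_le_mul_of_nonneg_right (le_max_left _ _) (Real.rpow_nonneg hn0 _)
      _ ≤ max C 0 * ((N : ℝ) ^ (1 - ε / 2) * (1 / (r : ℝ) ^ (3 / 2 : ℝ))) :=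
          mul_le_mul_of_nonneg_left hna hC0
      _ = _ := by ring
  -- the Möbius sums at `N/r²`, large `r`: trivially
  have hlarge : ∀ r ∈ Ioc R₀ (Nat.sqrt N),
      ‖∑ m ∈ Icc 1 (N / (r * r)), χ (m : ZMod q) * (moebius m : ℂ)‖ ≤ N * (1 / (r : ℝ) ^ 2) := by
    intro r _
    refine (LiouvilleCharSumLinnikBox.norm_moebius_twist_sum_le χ _).trans ?_
    refine (Nat.cast_div_le).trans (le_of_eq ?_); push_cast; ring
  have hsum := stubU2_sum_two_regimes_le hR₀1 (mul_nonneg hC0 (Real.rpow_nonneg hN0' _)) hN0'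
    hsmall hlarge
  rw [← hT] at hsum
  refine (LiouvilleCharSumLinnikBox.norm_sum_liouville_twist_le χ N).trans (hsum.trans ?_)
  -- `T C⁺ N^{1−ε/2} + N/R₀ ≤ (T C⁺ + 2) N^{1−ε/2}`
  have h1 : (N : ℝ) * (1 / R₀) ≤ 2 * (N : ℝ) ^ (1 - ε / 2) := by
    have e : (N : ℝ) ^ (4 / 5 : ℝ) * (N : ℝ) ^ (1 / 5 : ℝ) = N := by rw [ePow]; norm_num
    have h45 : (N : ℝ) ^ (4 / 5 : ℝ) ≤ (N : ℝ) ^ (1 - ε / 2) :=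
      Real.rpow_le_rpow_of_exponent_le hN1 ha45
    have hq2 : (N : ℝ) ^ (1 / 5 : ℝ) * (1 / R₀) ≤ 2 := by
      rw [mul_one_div, div_le_iff₀ hR₀0]; linarith
    calc (N : ℝ) * (1 / R₀) = (N : ℝ) ^ (4 / 5 : ℝ) * ((N : ℝ) ^ (1 / 5 : ℝ) * (1 / R₀)) := by
          rw [← mul_assoc, e]
      _ ≤ (N : ℝ) ^ (4 / 5 : ℝ) * 2 := mul_le_mul_of_nonneg_left hq2 (Real.rpow_nonneg hN0' _)
      _ ≤ (N : ℝ) ^ (1 - ε / 2) * 2 := mul_le_mul_of_nonneg_right h45 (by norm_num)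
      _ = 2 * (N : ℝ) ^ (1 - ε / 2) := mul_comm _ _
  calc T * (max C 0 * (N : ℝ) ^ (1 - ε / 2)) + (N : ℝ) * (1 / R₀)
      ≤ T * (max C 0 * (N : ℝ) ^ (1 - ε / 2)) + 2 * (N : ℝ) ^ (1 - ε / 2) := by linarith
    _ = (T * max C 0 + 2) * (N : ℝ) ^ (1 - ε / 2) := by ring

end Summit.Parity.GeneralizedHardyLittlewood.Theorems.TypeIILiouville

end
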